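import Summits.HodgeConjecture.HodgeConjecture.Theses.QbarEnvelope

/-!
# Route QbarEnvelope — `Assembly` (assembly item stmt-HodgeConjecture-1073)

The assembly item of route `QbarEnvelope`,

  (Hodge models) → PullbackAlgebraic → Envelope → HCOverNumberFields → HodgeConjecture,

is the route's deciding theorem `QbarEnvelope.closes` curried: its hypotheses are exactly the route items
named in the item (in another order), the Hodge-models antecedent being the route decl `HodgeModels`
unfolded (`∀ n X, nonempty_hodgeModel n X`, definitionally).  Pure logic over the route file; no
other import, no named-fact hypothesis, no sorry.
-/

-- `Summit.HodgeConjecture.HodgeConjecture.Theorems` is the mandated namespace (single-problem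
-- summit: Problem = Summit), which `linter.dupNamespace` flags on every declaration; the lakefile
-- turns the linter off tree-wide (weak option), restated here so stand-alone elaboration is
-- warning-free too.
set_option linter.dupNamespace false

namespace Summit.HodgeConjecture.HodgeConjecture.Theorems

/-- **Item stmt-HodgeConjecture-1073 (`Assembly`), route `QbarEnvelope`**: the route's items imply the
Hodge conjecture — literally the deciding theorem `QbarEnvelope.closes`, curried (the Hodge-models
antecedent is the route decl `HodgeModels` unfolded).  The type is the route decl `Summit.HodgeConjecture.HodgeConjecture.Theses.QbarEnvelope.Assembly`.
[cite: Deligne2000, §1] -/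
theorem qbarEnvelope_assembly_proof :
    Summit.HodgeConjecture.HodgeConjecture.Theses.QbarEnvelope.Assembly :=
  fun hM hP hE hC ↦
    Summit.HodgeConjecture.HodgeConjecture.Theses.QbarEnvelope.closes hE hC hP hM

end Summit.HodgeConjecture.HodgeConjecture.Theorems
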